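import Literature.MathematicalPhysics.QuantumLattice.TIGroundEnergyDensityCouplingFamilies
import HarnessLib

/-!
# Superlattice-periodic states: the cell average is translation invariant, so every certified
# translation-invariant energy floor binds every periodic (stripe / density-wave / enlarged-cell) state

Topic `Literature/MathematicalPhysics/QuantumLattice` (family `hubbard`; general dimension `d`, §4 also `ℤ²`).
Companion of `InfVolFermionState.lean` §3 (`shift`, `IsTranslationInvariant`, `mix`) and of
`TIGroundEnergyDensityResponse` / `…CouplingFamilies` (the translation-invariant variational densities
`tiGroundEnergyDensity`, `tiGroundEnergyDensityAt`). Written for stage S2 (CERTIFIER-FAMILIES) of the Hubbard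
material-oracle programme and its S3 «competing orders» consumers: the certified energy words of the
programme are worded for TRANSLATION-INVARIANT states (the variational class of `energyDensityTT'`,
`isLeast_meanEnergy_energyDensityTT'`), while the competing orders of record (stripes at `(8, ⅞)`, charge /
spin density waves, antiferromagnets with an enlarged cell) are SUPERLATTICE-PERIODIC states. This file closes
that gap once and for all at the level of infinite-volume states: the uniform average of a periodic state over
its fundamental cell is a translation-invariant state with the cell-averaged energy density and filling, so
every translation-invariant floor is a floor on the cell-averaged energy density of every periodic state. It is
also the first brick of the superlattice («multi-band by decoration», ladder, staggered-field) families: their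
natural variational classes are the periodic states introduced here.

* §1 `InfVolFermionState.shiftAverage pos ω = |κ|⁻¹ Σ_k ω ∘ τ_{pos k}` (a state; a finite convex combination of
  translates): its mean energy / density are the averages (`meanEnergy_shiftAverage`, `density_shiftAverage`),
  `(avg ω) ∘ τ_v = avg (ω ∘ τ_v)` (`shift_shiftAverage`), `avg ω = ω` for translation-invariant `ω`; and the
  generator lemma `isTranslationInvariant_of_shift_unitVec` (invariance under the `d` unit translations ⇒
  translation invariance).
* §2 `InfVolFermionState.IsPeriodic q ω` — invariance under the rectangular superlattice with periods
  `q_i + 1` (`periodVec q i = (q_i+1)e_i`); the fundamental cell `Cell q = Π_i Fin (q_i+1)` with positions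
  `cellPos`, its cyclic shifts `cellRotate q i` (bijections) and the wrap-around identity
  `pos(rot_i n) + [n_i last]·P_i = pos(n) + e_i`, whence `ω ∘ τ_{pos(n)+e_i} = ω ∘ τ_{pos(rot_i n)}` for periodic `ω`.
* §3 **THE CELL AVERAGE `ω̄ = cellAverage q ω` OF A `q`-PERIODIC STATE IS TRANSLATION INVARIANT**
  (`IsPeriodic.isTranslationInvariant_cellAverage`: a unit translation re-indexes the cell sum by `cellRotate`),
  with `e_Ψ(ω̄) = |C|⁻¹ Σ_{n∈C} e_Ψ(ω ∘ τ_{pos n})` (the cell-averaged energy density) and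
  `ρ(ω̄) = |C|⁻¹ Σ_n ρ(ω ∘ τ_{pos n})` (the cell-averaged filling).
* §4 CONSEQUENCES: for every interaction `Ψ` and every `q`-periodic `ω`,
  `tiGroundEnergyDensity Ψ R ≤ |C|⁻¹ Σ_n e_Ψ(ω ∘ τ_{pos n})` and, at the cell-averaged filling `ρ̄`,
  `tiGroundEnergyDensityAt Ψ R ρ̄ ≤ |C|⁻¹ Σ_n e_Ψ(ω ∘ τ_{pos n})` (so every certified translation-invariant floor
  `m ≤ e_{ρ̄}` is a floor for the periodic state, `le_cellAvg_of_le_tiGroundEnergyDensityAt`); for the `t–t'`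
  Hubbard model of `ℤ²` (`U ≥ 0`, `0 < ρ̄ < 2`): **`energyDensityTT' t t' U ρ̄ ≤ |C|⁻¹ Σ_n e_{Φ(t,t',U)}(ω ∘ τ_{pos n})`**
  — the certified lower rows of record bound the energy per site of every stripe / density-wave /
  antiferromagnetic superlattice state of the same mean filling.

Everything is PROVED; definitions with bodies (`shiftAverage`, `IsPeriodic`, `periodVec`, `Cell`, `cellPos`,
`cellRotate`, `cellAverage`), no named fact, no number of record, no `sorry`. HONEST SCOPE: one-sided
(floors); the statement is about infinite-volume states — the identification of `|C|⁻¹ Σ_n e_Ψ(ω ∘ τ_{pos n})`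
with `lim ω(H_Λ)/|Λ|` for periodic `ω` is the periodic twin of Bratteli–Robinson II §6.2.4 and is not restated
here; nothing bears on order / pairing words.

## Mathlib / tree search

REUSED: `InfVolFermionState.shift`, `shift_expect`, `shift_shift`, `shift_zero`, `IsTranslationInvariant`,
`expect_one/expect_nonneg/compatible`, `InfVolFermionState.ext`, `density`, `densityAt`, `meanEnergy`
(`InfVolFermionState`); `FermionInteraction.tiGroundEnergyDensity_le_meanEnergy` (`TIGroundEnergyDensityResponse`),
`tiGroundEnergyDensityAt_le_meanEnergy` (`TIGroundEnergyDensityCouplingFamilies`),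
`energyDensityTT'_le_meanEnergy_of_isTranslationInvariant` (`HubbardTTPrimeEnergyDensityVariationalPrinciple`);
Mathlib `finRotate`, `coe_finRotate`, `Equiv.piCongrRight`, `Equiv.sum_comp`, `Finset.univ_sum_single`,
`Int.induction_on`. `lean search 'IsPeriodic|cellAverage|shiftAverage|isTranslationInvariant_of' --decl` (QuantumLattice):
nothing (the PDE files' `IsPeriodic…` are unrelated).

## References

* O. Bratteli, D. W. Robinson, *OAQSM 1* (1987), §4.3.1 (`G`-invariant states, averages over a group action,
  convexity). [cite: BratteliRobinsonI1987, §4.3.1]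
* H. Araki, H. Moriya, Rev. Math. Phys. 15 (2003) 93, §4.1 Def. 4.3 / 4.5 (lattice translations, invariant
  states). [cite: ArakiMoriya2003, §4.1 Def. 4.5]
* O. Bratteli, A. Kishimoto, D. W. Robinson, CMP 64 (1978) 41, §3, Thm. 2 (mean energy; invariant ground
  states as minimisers). [cite: BratteliKishimotoRobinson1978, Thm. 2 (condition 2)]
* D. Ruelle, *Statistical Mechanics: Rigorous Results* (1969), §3.4. [cite: Ruelle1969, §3.4]
-/

noncomputable section

namespace Literature.MathematicalPhysics.QuantumLattice

open Matrix Finset HubbardWave0 Literature.Probability.LatticeModels ThermodynamicLimit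
open scoped ComplexOrder BigOperators

/-! ### §1. Uniform averages of finitely many translates of a state -/

namespace InfVolFermionState

variable {d : ℕ} {κ : Type*} [Fintype κ] [Nonempty κ]

/-- **The uniform average of the translates `ω ∘ τ_{pos k}`** over a finite non-empty index family of
lattice vectors: `(|κ|⁻¹) Σ_k ω ∘ τ_{pos k}` — again an infinite-volume state (a finite convex
combination). For `pos` an enumeration of a fundamental cell of a superlattice and `ω` periodic under that
superlattice this is the TRANSLATION AVERAGE of `ω` (§3). Bratteli–Robinson I §4.3.1 (convex combinations and
averages of states over a group action). [cite: BratteliRobinsonI1987, §4.3.1] -/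
def shiftAverage (pos : κ → Site d) (ω : InfVolFermionState d) : InfVolFermionState d where
  expect Λ := (((Fintype.card κ : ℝ)⁻¹ : ℝ) : ℂ) • ∑ k, (ω.shift (pos k)).expect Λ
  expect_one Λ := by
    have hκ : (Fintype.card κ : ℂ) ≠ 0 := Nat.cast_ne_zero.2 Fintype.card_ne_zero
    simp only [LinearMap.smul_apply, LinearMap.coe_sum, Finset.sum_apply, (ω.shift _).expect_one,
      Finset.sum_const, Finset.card_univ, nsmul_eq_mul, mul_one, Complex.ofReal_inv, Complex.ofReal_natCast,
      smul_eq_mul]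
    exact inv_mul_cancel₀ hκ
  expect_nonneg Λ A := by
    simp only [LinearMap.smul_apply, LinearMap.coe_sum, Finset.sum_apply, smul_eq_mul]
    exact mul_nonneg (Complex.zero_le_real.2 (inv_nonneg.2 (Nat.cast_nonneg _)))
      (Finset.sum_nonneg fun k _ => (ω.shift (pos k)).expect_nonneg Λ A)
  compatible Λ Λ' h A := by
    simp only [LinearMap.smul_apply, LinearMap.coe_sum, Finset.sum_apply, (ω.shift _).compatible h]

/-- The local expectations of the average (definitional unfolding). [cite: BratteliRobinsonI1987, §4.3.1] -/
theorem shiftAverage_expect (pos : κ → Site d) (ω : InfVolFermionState d) (Λ : Finset (Site d)) (A : FermionOp Λ) :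
    (ω.shiftAverage pos).expect Λ A = (((Fintype.card κ : ℝ)⁻¹ : ℝ) : ℂ) * ∑ k, (ω.shift (pos k)).expect Λ A := by
  simp only [shiftAverage, LinearMap.smul_apply, LinearMap.coe_sum, Finset.sum_apply, smul_eq_mul]

/-- **The mean energy of the average is the average of the mean energies** (the mean energy is affine).
[cite: BratteliKishimotoRobinson1978, §3 (mean energy functional)] -/
theorem meanEnergy_shiftAverage (pos : κ → Site d) (ω : InfVolFermionState d) (Ψ : FermionInteraction d) (R : ℝ) :
    (ω.shiftAverage pos).meanEnergy Ψ R = (Fintype.card κ : ℝ)⁻¹ * ∑ k, (ω.shift (pos k)).meanEnergy Ψ R := by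
  simp only [InfVolFermionState.meanEnergy, shiftAverage_expect, Complex.re_ofReal_mul, Complex.re_sum]

/-- **The density of the average is the average of the densities.** [cite: ArakiMoriya2003, §4.1] -/
theorem density_shiftAverage (pos : κ → Site d) (ω : InfVolFermionState d) :
    (ω.shiftAverage pos).density = (Fintype.card κ : ℝ)⁻¹ * ∑ k, (ω.shift (pos k)).density := by
  simp only [density, densityAt, shiftAverage_expect, Complex.re_ofReal_mul, Complex.re_sum]

/-- **Translating the average translates the state being averaged**: `(avg ω) ∘ τ_v = avg (ω ∘ τ_v)`
(translations commute). [cite: ArakiMoriya2003, §4.1 Def. 4.3 (τ is a group action)] -/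
theorem shift_shiftAverage (pos : κ → Site d) (ω : InfVolFermionState d) (v : Site d) :
    (ω.shiftAverage pos).shift v = (ω.shift v).shiftAverage pos := by
  refine InfVolFermionState.ext fun Λ => LinearMap.ext fun A => ?_
  rw [shift_expect, shiftAverage_expect, shiftAverage_expect]
  refine congrArg _ (Finset.sum_congr rfl fun k _ => ?_)
  rw [← shift_expect, shift_shift, shift_shift, add_comm]

/-- The average of a translation-invariant state is the state itself. [cite: BratteliRobinsonI1987, §4.3.1] -/
theorem IsTranslationInvariant.shiftAverage_eq (pos : κ → Site d) {ω : InfVolFermionState d}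
    (hω : ω.IsTranslationInvariant) : ω.shiftAverage pos = ω := by
  refine InfVolFermionState.ext fun Λ => LinearMap.ext fun A => ?_
  have hκ : (Fintype.card κ : ℂ) ≠ 0 := Nat.cast_ne_zero.2 Fintype.card_ne_zero
  rw [shiftAverage_expect]
  simp only [hω (pos _), Finset.sum_const, Finset.card_univ, nsmul_eq_mul, Complex.ofReal_inv,
    Complex.ofReal_natCast, ← mul_assoc, inv_mul_cancel₀ hκ, one_mul]

/-- **Translation invariance from the `d` unit translations**: a state invariant under `τ_{e_i}` for every
`i` is invariant under all of `ℤ^d`. [cite: ArakiMoriya2003, §4.1 Def. 4.5] -/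
theorem isTranslationInvariant_of_shift_unitVec {ω : InfVolFermionState d}
    (h : ∀ i : Fin d, ω.shift (unitVec i) = ω) : ω.IsTranslationInvariant := by
  -- inverse unit steps
  have hneg : ∀ i : Fin d, ω.shift (-unitVec i) = ω := by
    intro i
    conv_lhs => rw [← h i]
    rw [shift_shift, neg_add_cancel, shift_zero]
  -- integer multiples of a unit step
  have hz : ∀ (i : Fin d) (z : ℤ), ω.shift (z • unitVec i) = ω := by
    intro i z
    induction z using Int.induction_on with
    | zero => rw [zero_smul, shift_zero]
    | succ k ih => rw [add_smul, one_smul, ← shift_shift, h i, ih]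
    | pred k ih => rw [sub_eq_add_neg, add_smul, neg_one_smul, ← shift_shift, hneg i, ih]
  -- all of `ℤ^d`, by induction over the coordinates
  have hsum : ∀ (v : Site d) (s : Finset (Fin d)), ω.shift (∑ i ∈ s, v i • unitVec i) = ω := by
    intro v s
    induction s using Finset.induction_on with
    | empty => rw [Finset.sum_empty, shift_zero]
    | insert a s ha ih => rw [Finset.sum_insert ha, add_comm, ← shift_shift, hz a, ih]
  intro v
  have hv : v = ∑ i : Fin d, v i • (unitVec i : Site d) := by
    conv_lhs => rw [← Finset.univ_sum_single v]
    exact Finset.sum_congr rfl fun i _ => by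
      rw [unitVec, ← Pi.single_smul', smul_eq_mul, mul_one]
  rw [hv]
  exact hsum v Finset.univ

end InfVolFermionState

/-! ### §2. Superlattice-periodic states and the fundamental cell -/

section Periodic

variable {d : ℕ}

/-- The `i`-th period vector `(q_i + 1) e_i` of the rectangular superlattice with periods `q_i + 1`.
[cite: ArakiMoriya2003, §4.1] -/
def periodVec (q : Fin d → ℕ) (i : Fin d) : Site d := Pi.single i ((q i : ℤ) + 1)

/-- **A state is `q`-PERIODIC** (periods `q_i + 1 ≥ 1` along the axes): `ω ∘ τ_{(q_i+1)e_i} = ω` for every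
`i` — invariance under the rectangular superlattice `⊕_i (q_i+1)ℤ e_i` (stripe, checkerboard, any enlarged
unit cell). Translation-invariant states are `q`-periodic for every `q`; `q = 0` is translation invariance.
[cite: ArakiMoriya2003, §4.1 Def. 4.5] -/
def InfVolFermionState.IsPeriodic (q : Fin d → ℕ) (ω : InfVolFermionState d) : Prop :=
  ∀ i : Fin d, ω.shift (periodVec q i) = ω

/-- Translation-invariant states are periodic under every superlattice. [cite: ArakiMoriya2003, §4.1 Def. 4.5] -/
theorem InfVolFermionState.IsTranslationInvariant.isPeriodic {ω : InfVolFermionState d}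
    (hω : ω.IsTranslationInvariant) (q : Fin d → ℕ) : ω.IsPeriodic q := fun _ => hω _

/-- A periodic state absorbs a period: `ω ∘ τ_{v + P_i} = ω ∘ τ_v`. [cite: ArakiMoriya2003, §4.1 Def. 4.3] -/
theorem InfVolFermionState.IsPeriodic.shift_add_periodVec {q : Fin d → ℕ} {ω : InfVolFermionState d}
    (hω : ω.IsPeriodic q) (v : Site d) (i : Fin d) : ω.shift (v + periodVec q i) = ω.shift v := by
  rw [← InfVolFermionState.shift_shift, hω i]

/-- **The fundamental cell** of the superlattice: index type `Π_i Fin (q_i + 1)` (`|cell| = Π_i (q_i+1)`).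
[cite: ArakiMoriya2003, §4.1] -/
abbrev Cell (q : Fin d → ℕ) : Type := (i : Fin d) → Fin (q i + 1)

/-- The lattice position `(n_i)_i ∈ ℤ^d` of a cell point. [cite: ArakiMoriya2003, §4.1] -/
def cellPos {q : Fin d → ℕ} (n : Cell q) : Site d := fun i => ((n i : ℕ) : ℤ)

/-- **The cyclic shift of the cell along the axis `i`** (`n_i ↦ n_i + 1 mod (q_i+1)`, other coordinates
fixed): a bijection of the cell. [cite: ArakiMoriya2003, §4.1] -/
def cellRotate (q : Fin d → ℕ) (i : Fin d) : Cell q ≃ Cell q :=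
  Equiv.piCongrRight fun j => (finRotate (q j + 1)) ^ (if j = i then 1 else 0)

/-- The rotated coordinate: `(cellRotate q i n)_i = finRotate n_i`, other coordinates unchanged.
[cite: ArakiMoriya2003, §4.1] -/
theorem cellRotate_apply (q : Fin d → ℕ) (i : Fin d) (n : Cell q) (j : Fin d) :
    cellRotate q i n j = if j = i then finRotate (q j + 1) (n j) else n j := by
  by_cases hj : j = i
  · simp [cellRotate, hj]
  · simp [cellRotate, hj]

/-- **Position of the rotated cell point**: `pos(rot_i n) + [n_i is last]·P_i = pos(n) + e_i` — stepping
along `e_i` inside the cell, wrapping around by one period at the far face. [cite: ArakiMoriya2003, §4.1] -/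
theorem cellPos_cellRotate_add (q : Fin d → ℕ) (i : Fin d) (n : Cell q) :
    cellPos (cellRotate q i n) + (if n i = Fin.last (q i) then periodVec q i else 0) = cellPos n + unitVec i := by
  funext j
  simp only [Pi.add_apply, cellPos, cellRotate_apply]
  by_cases hj : j = i
  · subst hj
    simp only [if_true, coe_finRotate, unitVec, Pi.single_eq_same]
    by_cases hl : n j = Fin.last (q j)
    · rw [if_pos hl, if_pos hl, periodVec, Pi.single_eq_same, hl, Fin.val_last]
      push_cast
      ring
    · rw [if_neg hl, if_neg hl, Pi.zero_apply, add_zero]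
      push_cast
      ring
  · rw [if_neg hj, unitVec, Pi.single_eq_of_ne hj]
    by_cases hl : n i = Fin.last (q i)
    · rw [if_pos hl, periodVec, Pi.single_eq_of_ne hj]
    · rw [if_neg hl, Pi.zero_apply]

/-- **A periodic state steps through its cell**: `ω ∘ τ_{pos(n) + e_i} = ω ∘ τ_{pos(rot_i n)}`.
[cite: ArakiMoriya2003, §4.1 Def. 4.5] -/
theorem InfVolFermionState.IsPeriodic.shift_cellPos_add_unitVec {q : Fin d → ℕ} {ω : InfVolFermionState d}
    (hω : ω.IsPeriodic q) (i : Fin d) (n : Cell q) :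
    ω.shift (cellPos n + unitVec i) = ω.shift (cellPos (cellRotate q i n)) := by
  rw [← cellPos_cellRotate_add q i n]
  by_cases hl : n i = Fin.last (q i)
  · rw [if_pos hl, hω.shift_add_periodVec]
  · rw [if_neg hl, add_zero]

end Periodic

/-! ### §3. The translation average of a periodic state is translation invariant -/

section Average

variable {d : ℕ} {q : Fin d → ℕ}

/-- **The cell average of a periodic state**: `ω̄ := |C|⁻¹ Σ_{n ∈ C} ω ∘ τ_{pos(n)}` over the fundamental
cell `C = Π_i Fin (q_i+1)`. [cite: BratteliRobinsonI1987, §4.3.1] -/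
abbrev InfVolFermionState.cellAverage (q : Fin d → ℕ) (ω : InfVolFermionState d) : InfVolFermionState d :=
  ω.shiftAverage (cellPos (q := q))

/-- **A unit translation permutes the cell average of a periodic state back to itself**:
`ω̄ ∘ τ_{e_i} = ω̄`. [cite: BratteliRobinsonI1987, §4.3.1] -/
theorem InfVolFermionState.IsPeriodic.shift_unitVec_cellAverage {ω : InfVolFermionState d} (hω : ω.IsPeriodic q)
    (i : Fin d) : (ω.cellAverage q).shift (unitVec i) = ω.cellAverage q := by
  rw [InfVolFermionState.cellAverage, InfVolFermionState.shift_shiftAverage]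
  refine InfVolFermionState.ext fun Λ => LinearMap.ext fun A => ?_
  rw [InfVolFermionState.shiftAverage_expect, InfVolFermionState.shiftAverage_expect]
  refine congrArg _ ?_
  have hterm : ∀ n : Cell q, ((ω.shift (unitVec i)).shift (cellPos n)).expect Λ A =
      (ω.shift (cellPos (cellRotate q i n))).expect Λ A := by
    intro n
    rw [InfVolFermionState.shift_shift, hω.shift_cellPos_add_unitVec i n]
  simp only [hterm]
  exact (cellRotate q i).sum_comp (fun n => (ω.shift (cellPos n)).expect Λ A)

/-- **THE CELL AVERAGE OF A PERIODIC STATE IS TRANSLATION INVARIANT.** [cite: BratteliRobinsonI1987, §4.3.1] -/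
theorem InfVolFermionState.IsPeriodic.isTranslationInvariant_cellAverage {ω : InfVolFermionState d}
    (hω : ω.IsPeriodic q) : (ω.cellAverage q).IsTranslationInvariant :=
  InfVolFermionState.isTranslationInvariant_of_shift_unitVec fun i => hω.shift_unitVec_cellAverage i

/-- Its mean energy is the CELL-AVERAGED ENERGY DENSITY `|C|⁻¹ Σ_{n∈C} e_Ψ(ω ∘ τ_{pos n})` of the periodic
state (the energy per site of a superlattice-ordered state). [cite: BratteliKishimotoRobinson1978, §3 (mean energy functional)] -/
theorem InfVolFermionState.meanEnergy_cellAverage (ω : InfVolFermionState d) (Ψ : FermionInteraction d) (R : ℝ) :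
    (ω.cellAverage q).meanEnergy Ψ R =
      (Fintype.card (Cell q) : ℝ)⁻¹ * ∑ n : Cell q, (ω.shift (cellPos n)).meanEnergy Ψ R :=
  ω.meanEnergy_shiftAverage _ Ψ R

/-- Its density is the CELL-AVERAGED DENSITY `|C|⁻¹ Σ_{n∈C} ρ(ω ∘ τ_{pos n})` (the filling per site of the
superlattice-ordered state). [cite: ArakiMoriya2003, §4.1] -/
theorem InfVolFermionState.density_cellAverage (ω : InfVolFermionState d) :
    (ω.cellAverage q).density = (Fintype.card (Cell q) : ℝ)⁻¹ * ∑ n : Cell q, (ω.shift (cellPos n)).density :=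
  ω.density_shiftAverage _

end Average

/-! ### §4. Consequence: certified translation-invariant floors bind EVERY periodic state -/

section Floors

variable {d : ℕ} {q : Fin d → ℕ}

/-- **The translation-invariant variational density is below the cell-averaged energy density of every
periodic state** (any interaction `Ψ`, any range parameter): `e₀(Ψ) ≤ |C|⁻¹ Σ_{n∈C} e_Ψ(ω ∘ τ_{pos n})` —
superlattice order (stripes, charge / spin density waves, any enlarged unit cell) cannot go below the
translation-invariant infimum, because the cell average competes in the translation-invariant class.
[cite: BratteliKishimotoRobinson1978, Thm. 2 (condition 2)] -/
theorem InfVolFermionState.IsPeriodic.tiGroundEnergyDensity_le_cellAvg {ω : InfVolFermionState d}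
    (hω : ω.IsPeriodic q) (Ψ : FermionInteraction d) (R : ℝ) :
    Ψ.tiGroundEnergyDensity R ≤ (Fintype.card (Cell q) : ℝ)⁻¹ * ∑ n : Cell q, (ω.shift (cellPos n)).meanEnergy Ψ R := by
  rw [← ω.meanEnergy_cellAverage Ψ R]
  exact Ψ.tiGroundEnergyDensity_le_meanEnergy R hω.isTranslationInvariant_cellAverage

/-- **Fixed filling**: with `ρ̄ = |C|⁻¹ Σ_n ρ(ω ∘ τ_{pos n})` the cell-averaged density of the periodic state,
`e_{ρ̄}(Ψ) ≤ |C|⁻¹ Σ_n e_Ψ(ω ∘ τ_{pos n})`. [cite: BratteliKishimotoRobinson1978, Thm. 2 (condition 2)] -/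
theorem InfVolFermionState.IsPeriodic.tiGroundEnergyDensityAt_le_cellAvg {ω : InfVolFermionState d}
    (hω : ω.IsPeriodic q) (Ψ : FermionInteraction d) (R : ℝ) :
    Ψ.tiGroundEnergyDensityAt R ((Fintype.card (Cell q) : ℝ)⁻¹ * ∑ n : Cell q, (ω.shift (cellPos n)).density) ≤
      (Fintype.card (Cell q) : ℝ)⁻¹ * ∑ n : Cell q, (ω.shift (cellPos n)).meanEnergy Ψ R := by
  rw [← ω.meanEnergy_cellAverage Ψ R, ← ω.density_cellAverage]
  exact Ψ.tiGroundEnergyDensityAt_le_meanEnergy R hω.isTranslationInvariant_cellAverage rfl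

/-- **A certified translation-invariant floor is a floor for every periodic state**: `m ≤ e_{ρ̄}(Ψ)` ⇒
`m ≤ |C|⁻¹ Σ_n e_Ψ(ω ∘ τ_{pos n})` for every `q`-periodic `ω` of cell-averaged density `ρ̄`.
[cite: BratteliKishimotoRobinson1978, Thm. 2 (condition 2)] -/
theorem InfVolFermionState.IsPeriodic.le_cellAvg_of_le_tiGroundEnergyDensityAt {ω : InfVolFermionState d}
    (hω : ω.IsPeriodic q) (Ψ : FermionInteraction d) (R : ℝ) {m : ℝ}
    (hm : m ≤ Ψ.tiGroundEnergyDensityAt R ((Fintype.card (Cell q) : ℝ)⁻¹ * ∑ n : Cell q, (ω.shift (cellPos n)).density)) :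
    m ≤ (Fintype.card (Cell q) : ℝ)⁻¹ * ∑ n : Cell q, (ω.shift (cellPos n)).meanEnergy Ψ R :=
  hm.trans (hω.tiGroundEnergyDensityAt_le_cellAvg Ψ R)

/-- **The `t–t'` Hubbard model of `ℤ²`**: Ruelle's thermodynamic-limit energy density at the cell-averaged
filling `ρ̄ ∈ (0,2)` is below the cell-averaged energy density of EVERY periodic state (`U ≥ 0`):
`energyDensityTT' t t' U ρ̄ ≤ |C|⁻¹ Σ_{n∈C} e_{Φ(t,t',U)}(ω ∘ τ_{pos n})` — every certified lower row of the
programme binds stripe / density-wave / antiferromagnetic superlattice states verbatim.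
[cite: Ruelle1969, §3.4] -/
theorem InfVolFermionState.IsPeriodic.energyDensityTT'_le_cellAvg {q : Fin 2 → ℕ} {ω : InfVolFermionState 2}
    (hω : ω.IsPeriodic q) (t t' : ℝ) {U : ℝ} (hU : 0 ≤ U)
    (hρ0 : 0 < (Fintype.card (Cell q) : ℝ)⁻¹ * ∑ n : Cell q, (ω.shift (cellPos n)).density)
    (hρ2 : (Fintype.card (Cell q) : ℝ)⁻¹ * ∑ n : Cell q, (ω.shift (cellPos n)).density < 2) :
    energyDensityTT' t t' U ((Fintype.card (Cell q) : ℝ)⁻¹ * ∑ n : Cell q, (ω.shift (cellPos n)).density) ≤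
      (Fintype.card (Cell q) : ℝ)⁻¹ * ∑ n : Cell q, (ω.shift (cellPos n)).meanEnergy (hubbardTTPrimeFermionInteraction t t' U) 1 := by
  rw [← ω.meanEnergy_cellAverage _ 1, ← ω.density_cellAverage] at *
  exact InfVolFermionState.energyDensityTT'_le_meanEnergy_of_isTranslationInvariant t t' hU hρ0 hρ2
    hω.isTranslationInvariant_cellAverage rfl

end Floors

end Literature.MathematicalPhysics.QuantumLattice

end
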